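import Summits.AtomisticToContinuum.Crystallization.Theses.FreeSplittingCertificates
import Literature.MathematicalPhysics.StatisticalMechanics.LennardJonesThermodynamicLimitProofs

/-!
# Route `FreeSplittingCertificates`, item stmt-AtomisticToContinuum-12564 `SlackDensity`

For a pair-splitting rule `Φ` (box `0 ≤ Φ ≤ 1` and complementarity
`Φ v T + Φ (-v) (T - v) = 1`) that is feasible on Lennard-Jones ground states (every weighted site
energy is `≥ e_∞ := ⨅_M E(M+1)/(M+1)`), and any `c > 0`, along every sequence of ground states the
fraction of sites whose weighted site energy is `≥ e_∞ + c` tends to `0`.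

Proof.  On a ground state `x` (injective) the realised patterns satisfy `T_ji = T_ij - (x_j - x_i)`,
so complementarity gives `w_ij + w_ji = 1` and hence `∑_i (weighted site energy)_i = 𝓔_N(x) = E(N)`.
Each slack `(site energy)_i - e_∞` is `≥ 0` by feasibility, so Markov's inequality bounds the number
of sites with slack `≥ c` by `(E(N) - N e_∞)/c ≤ (E(N) - N e)/c` where `e = lim E(N)/N ≤ e_∞`
(`BlancLewin2015_8_holds`), and `E(N)/N - e → 0`.
-/

namespace Summit.AtomisticToContinuum.Crystallization.Theorems

open Literature.MathematicalPhysics.StatisticalMechanics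
open Filter Topology
open scoped Classical

/-- Splitting an off-diagonal double sum over `Fin N` into unordered pairs:
`∑_k ∑_{j ≠ k} g k j = ∑_k ∑_{j > k} (g k j + g j k)`. -/
theorem slackDensity_sum_erase_eq_sum_Ioi {N : ℕ} (g : Fin N → Fin N → ℝ) :
    ∑ k, ∑ j ∈ Finset.univ.erase k, g k j = ∑ k, ∑ j ∈ Finset.Ioi k, (g k j + g j k) := by
  have hsplit : ∀ k : Fin N, ∑ j ∈ Finset.univ.erase k, g k j =
      ∑ j ∈ Finset.Ioi k, g k j + ∑ j ∈ Finset.Iio k, g k j := by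
    intro k
    rw [← Finset.sum_union]
    · refine Finset.sum_congr ?_ fun _ _ => rfl
      ext j
      simp only [Finset.mem_erase, Finset.mem_univ, and_true, Finset.mem_union, Finset.mem_Ioi,
        Finset.mem_Iio]
      constructor
      · intro h
        rcases lt_or_gt_of_ne h with h | h
        · exact Or.inr h
        · exact Or.inl h
      · rintro (h | h)
        · exact h.ne'
        · exact h.ne
    · exact Finset.disjoint_left.2 fun j h₁ h₂ =>
        lt_asymm (Finset.mem_Ioi.1 h₁) (Finset.mem_Iio.1 h₂)
  simp_rw [hsplit, Finset.sum_add_distrib]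
  congr 1
  exact Finset.sum_comm' fun k j => by simp

/-- Complementary bond weights (`w k j + w j k = 1` for `k ≠ j`) split the interaction energy exactly:
the weighted site energies `∑_{j ≠ k} w k j · V(|x_k - x_j|)` sum to `𝓔_N(x)`. -/
theorem slackDensity_sum_weighted_eq_interactionEnergy {N : ℕ} (V : ℝ → ℝ)
    (x : Fin N → EuclideanSpace ℝ (Fin 3)) (w : Fin N → Fin N → ℝ)
    (hw : ∀ k j, k ≠ j → w k j + w j k = 1) :
    ∑ k, ∑ j ∈ Finset.univ.erase k, w k j * V (dist (x k) (x j)) = interactionEnergy V x := by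
  rw [slackDensity_sum_erase_eq_sum_Ioi]
  unfold interactionEnergy
  refine Finset.sum_congr rfl fun k _ => Finset.sum_congr rfl fun j hj => ?_
  have hkj : k ≠ j := (Finset.mem_Ioi.1 hj).ne
  rw [dist_comm (x j) (x k), ← add_mul, hw k j hkj, one_mul]

/-- Realised patterns are complementary: recentring the joint `R`-pattern of the bond `(k, j)` seen
from `x_k` by `x_j - x_k` gives the joint pattern of the bond `(j, k)` seen from `x_j`. -/
theorem slackDensity_pattern_swap {N : ℕ} (R : ℝ) (x : Fin N → EuclideanSpace ℝ (Fin 3))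
    (k j : Fin N) :
    ((Finset.univ.filter fun l => dist (x l) (x k) ≤ R ∨ dist (x l) (x j) ≤ R).image
        fun l => x l - x k).image (fun u => u - (x j - x k)) =
      (Finset.univ.filter fun l => dist (x l) (x j) ≤ R ∨ dist (x l) (x k) ≤ R).image
        fun l => x l - x j := by
  rw [Finset.image_image]
  have hf : (Finset.univ.filter fun l => dist (x l) (x k) ≤ R ∨ dist (x l) (x j) ≤ R) =
      (Finset.univ.filter fun l => dist (x l) (x j) ≤ R ∨ dist (x l) (x k) ≤ R) :=
    Finset.filter_congr fun l _ => or_comm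
  rw [hf]
  refine Finset.image_congr fun l _ => ?_
  simp only [Function.comp_apply, sub_sub_sub_cancel_right]

/-- Markov counting step: if site quantities `s N k ≥ e₀` sum to `E N` for every `N`, and
`E N / N → e ≤ e₀`, then for every `c > 0` the fraction of sites with `s N k ≥ e₀ + c` tends to `0`. -/
theorem slackDensity_tendsto_card_div {e₀ e c : ℝ} {E : ℕ → ℝ} {s : (N : ℕ) → Fin N → ℝ}
    (hc : 0 < c) (he : e ≤ e₀) (hE : Tendsto (fun N : ℕ => E N / N) atTop (𝓝 e))
    (hsum : ∀ N, ∑ k, s N k = E N) (hfeas : ∀ N k, e₀ ≤ s N k) :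
    Tendsto (fun N : ℕ => (Nat.card {k : Fin N // e₀ + c ≤ s N k} : ℝ) / N) atTop (𝓝 0) := by
  have hbound : ∀ N : ℕ, c * (Nat.card {k : Fin N // e₀ + c ≤ s N k} : ℝ) ≤ E N - N * e₀ := by
    intro N
    rw [Nat.card_eq_fintype_card, Fintype.card_subtype]
    set A := Finset.univ.filter (fun k : Fin N => e₀ + c ≤ s N k) with hA
    have h1 : (A.card : ℝ) * c ≤ ∑ k ∈ A, (s N k - e₀) := by
      have h := Finset.card_nsmul_le_sum A (fun k => s N k - e₀) c (fun k hk => by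
        have hk' := (Finset.mem_filter.1 hk).2
        linarith)
      rw [nsmul_eq_mul] at h
      exact h
    have h2 : ∑ k ∈ A, (s N k - e₀) ≤ ∑ k, (s N k - e₀) :=
      Finset.sum_le_univ_sum_of_nonneg fun k => sub_nonneg.2 (hfeas N k)
    have h3 : ∑ k : Fin N, (s N k - e₀) = E N - N * e₀ := by
      rw [Finset.sum_sub_distrib, hsum, Finset.sum_const, Finset.card_univ, Fintype.card_fin,
        nsmul_eq_mul]
    linarith [h1, h2, h3]
  refine squeeze_zero' (g := fun N : ℕ => (E N / N - e) / c)
    (Eventually.of_forall fun N => div_nonneg (Nat.cast_nonneg _) (Nat.cast_nonneg _)) ?_ ?_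
  · filter_upwards [eventually_gt_atTop 0] with N hN
    have hN' : (0 : ℝ) < N := Nat.cast_pos.2 hN
    rw [le_div_iff₀ hc, div_mul_eq_mul_div, div_le_iff₀ hN']
    have h4 : (E N / N - e) * N = E N - N * e := by
      field_simp
    have h5 : (N : ℝ) * e ≤ N * e₀ := mul_le_mul_of_nonneg_left he hN'.le
    rw [h4]
    linarith [hbound N]
  · have h := (hE.sub_const e).div_const c
    simpa using h

/-- **Item stmt-AtomisticToContinuum-12564** (`SlackDensity`, support of route
`FreeSplittingCertificates`): for any box + complementary pair-splitting rule that is feasible on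
Lennard-Jones ground states and any `c > 0`, along every sequence of ground states the fraction of
sites with weighted site energy `≥ e_∞ + c` tends to `0` (Markov on the nonnegative slacks, whose
total is `E(N) - N e_∞ = o(N)` by `BlancLewin2015_8_holds`). -/
theorem slackDensity_proof :
    Summit.AtomisticToContinuum.Crystallization.Theses.FreeSplittingCertificates.SlackDensity := by
  unfold Summit.AtomisticToContinuum.Crystallization.Theses.FreeSplittingCertificates.SlackDensity
  intro R Φ hΦ hfeas c hc x hx
  obtain ⟨e, -, htend, hle⟩ := BlancLewin2015_8_holds 3 (by norm_num) (by norm_num)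
  have he : e ≤ ⨅ M : ℕ, groundStateEnergy lennardJones 3 (M + 1) / ((M + 1 : ℕ) : ℝ) :=
    le_ciInf fun M => hle (M + 1) M.succ_pos
  refine slackDensity_tendsto_card_div hc he htend (fun N => ?_)
    (fun N k => hfeas N (x N) (hx N) k)
  obtain ⟨hinj, hEN⟩ := hx N
  rw [← hEN]
  refine slackDensity_sum_weighted_eq_interactionEnergy lennardJones (x N) _ fun k j hkj => ?_
  have hv : x N j - x N k ≠ 0 := sub_ne_zero.2 (hinj.ne hkj.symm)
  have h := hΦ.2 (x N j - x N k)
    ((Finset.univ.filter fun l => dist (x N l) (x N k) ≤ R ∨ dist (x N l) (x N j) ≤ R).image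
      fun l => x N l - x N k) hv
  rw [neg_sub, slackDensity_pattern_swap] at h
  exact h

end Summit.AtomisticToContinuum.Crystallization.Theorems
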